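import Literature.Barriers.CriticalPhenomena.PositionSpaceRGNonGibbsianIsraelComparison
import HarnessLib

/-!
# Israel's example (van Enter–Fernández–Sokal 1993, §4.1.2): the decorated lattice of Step 1 —
# centres, midpoints and the rescaled lattice

Companion file of `PositionSpaceRGNonGibbsianIsraelGeometry.lean`, preparing the dedecoration of
Steps 1–2: "the modified object system is simply a ferromagnetic Ising model in zero field on a
decorated lattice [342], as shown in Figure 3(b). Now we can explicitly integrate out the spins in
the decorated lattice that have exactly two neighbors, yielding an effective coupling
`J' = ½ log cosh 2J` between those two neighbors. The result is an ordinary ferromagnetic Ising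
model on `ℤ²` … [Figure 3(c)]" (p. 94); in Step 2 the same for the finite system: "We can
explicitly integrate out the spins in `Λ^int_{R+1}` that have exactly two neighbors (namely, the
spins that have one coordinate even and one coordinate odd) … Similarly, we can integrate out the
spins in `Γ^int_{R+2}` … But this last system is equivalent to a square lattice of size
`(R+2) × (R+2)` with nearest-neighbor coupling `J'` and `+` boundary conditions" (p. 97).

The internal sites of `Λ_{2n+2}` are of two kinds: CENTRES (both coordinates odd; the sites of the
`(R+2) × (R+2)` square, `R = 2n`) and MIDPOINTS (one coordinate even; the spins with exactly two
neighbours, or one neighbour plus the field `+J` on layer `Γ_{2n+2}`). This file parametrises both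
by the rescaled lattice `ℤ²`: centres by `centerEmb x = 2x + (1,1)` with `x` in the rescaled box
`rescaledBox n = [-(n+1), n]²`, midpoints by the anchored bonds of `ℤ²` meeting the rescaled box
(`midOf (u, i) = centerEmb u + eᵢ`, the midpoint of the centres `centerEmb u`, `centerEmb (u+eᵢ)`),
and proves the partition `internalVolume n = centerFinset n ∪ midFinset n`.

## What is formalised (namespace `Literature.Barriers.CriticalPhenomena.NonGibbs`)

`centerEmb`, `rescaledBox`, `midOf`, `midFinset`, `centerFinset` (`= internalVolume n ∖ midFinset
n`, `= (rescaledBox n).map centerEmb`), their membership/parity lemmas, `midOf_injective`,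
`internalVolume_eq_union`, and the neighbour bookkeeping of centres and midpoints. All proved; no
named facts.
-/

noncomputable section

namespace Literature.Barriers.CriticalPhenomena.NonGibbs

open Finset Literature.Probability.LatticeModels Literature.Probability.LatticeModels.AEdge

/-! ### A small `Fin 2` helper -/

/-- The other index of `Fin 2`. [folklore] -/
theorem exists_fin_two_ne (i : Fin 2) : ∃ j : Fin 2, j ≠ i := by
  fin_cases i
  · exact ⟨1, by decide⟩
  · exact ⟨0, by decide⟩

/-! ### Centres: the rescaled lattice `x ↦ 2x + (1,1)` -/

/-- **The centres**: `x ↦ 2x + (1,1)`, the embedding of the rescaled lattice `ℤ²` onto the sites of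
`ℤ²` with both coordinates odd (the sites of "the equivalent nearest-neighbor interaction on
`(2ℤ)²`" of Figure 3(c), here written on `(2ℤ+1)²` around the origin image spin).
[cite: VanenterFernandezSokal1993, §4.1.2 Step 1, Figure 3(c)] -/
def centerEmb : Site 2 ↪ Site 2 :=
  ⟨fun x => double x + 1, fun x y h => by
    funext i
    have := congr_fun h i
    simp only [Pi.add_apply, double, Pi.one_apply] at this
    omega⟩

/-- Coordinates of a centre: `(2x + (1,1))_k = 2x_k + 1`. [cite: VanenterFernandezSokal1993, §4.1.2 Step 1] -/
@[simp] theorem centerEmb_apply (x : Site 2) (k : Fin 2) : centerEmb x k = 2 * x k + 1 := by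
  simp [centerEmb, double]

/-- Centres have odd coordinates. [cite: VanenterFernandezSokal1993, §4.1.2 Step 1] -/
theorem odd_centerEmb_apply (x : Site 2) (k : Fin 2) : Odd (centerEmb x k) :=
  ⟨x k, by rw [centerEmb_apply]⟩

/-- Centres are not image sites. [cite: VanenterFernandezSokal1993, §4.1.2 Step 1] -/
theorem not_isImageSite_centerEmb (x : Site 2) : ¬ IsImageSite (centerEmb x) := fun h =>
  Int.not_even_iff_odd.2 (odd_centerEmb_apply x 0) h.1

/-- **The rescaled box** `[-(n+1), n]²`: the centres of `Λ_{2n+2}` are `centerEmb` of its points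
("a square lattice of size `(R+2) × (R+2)`", `R = 2n`). [cite: VanenterFernandezSokal1993, §4.1.2 Step 2, Figure 4(e)] -/
def rescaledBox (n : ℕ) : Finset (Site 2) :=
  Fintype.piFinset fun _ : Fin 2 => Finset.Icc (-(n : ℤ) - 1) n

/-- Membership in the rescaled box. [cite: VanenterFernandezSokal1993, §4.1.2 Step 2] -/
@[simp] theorem mem_rescaledBox {n : ℕ} {x : Site 2} :
    x ∈ rescaledBox n ↔ ∀ k, -(n : ℤ) - 1 ≤ x k ∧ x k ≤ n := by
  simp [rescaledBox, Fintype.mem_piFinset]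

/-- A centre lies in `Λ_{2n+2}` iff its rescaled coordinates lie in `[-(n+1), n]²`.
[cite: VanenterFernandezSokal1993, §4.1.2 Step 2] -/
theorem centerEmb_mem_box_iff {n : ℕ} {x : Site 2} :
    centerEmb x ∈ box 2 (2 * n + 2) ↔ x ∈ rescaledBox n := by
  rw [mem_box, mem_rescaledBox]
  constructor
  · intro h k
    have := h k
    rw [centerEmb_apply] at this
    push_cast at this
    omega
  · intro h k
    have := h k
    rw [centerEmb_apply]
    push_cast
    omega

/-- Centres of the box are internal sites. [cite: VanenterFernandezSokal1993, §4.1.2 Step 2] -/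
theorem centerEmb_mem_internalVolume {n : ℕ} {x : Site 2} (hx : x ∈ rescaledBox n) :
    centerEmb x ∈ internalVolume n :=
  mem_internalVolume_iff.2 ⟨centerEmb_mem_box_iff.2 hx, not_isImageSite_centerEmb x⟩

/-! ### Midpoints: the anchored bonds of the rescaled lattice -/

/-- **The midpoint of an anchored bond of the rescaled lattice**: `midOf (u, i) = centerEmb u + eᵢ`,
the site of `ℤ²` halfway between the centres `centerEmb u` and `centerEmb (u + eᵢ) = centerEmb u + 2eᵢ`
— "the spins in the decorated lattice that have exactly two neighbors".
[cite: VanenterFernandezSokal1993, §4.1.2 Step 1, Figure 3(b)] -/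
def midOf (ε : AEdge) : Site 2 := centerEmb ε.1 + vec ε.2

/-- Coordinates of a midpoint: even (`2u_i + 2`) along the bond, odd elsewhere.
[cite: VanenterFernandezSokal1993, §4.1.2 Step 1] -/
theorem midOf_apply_same (ε : AEdge) : midOf ε ε.2 = 2 * ε.1 ε.2 + 2 := by
  simp [midOf, vec_apply_same]; ring

/-- The other coordinate of a midpoint is that of its centres. [cite: VanenterFernandezSokal1993, §4.1.2 Step 1] -/
theorem midOf_apply_ne (ε : AEdge) {k : Fin 2} (hk : k ≠ ε.2) : midOf ε k = 2 * ε.1 k + 1 := by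
  simp [midOf, vec_apply_ne hk]

/-- The coordinate of a midpoint along its bond is even. [cite: VanenterFernandezSokal1993, §4.1.2 Step 1] -/
theorem even_midOf_apply_same (ε : AEdge) : Even (midOf ε ε.2) :=
  ⟨ε.1 ε.2 + 1, by rw [midOf_apply_same]; ring⟩

/-- The other coordinate of a midpoint is odd. [cite: VanenterFernandezSokal1993, §4.1.2 Step 1] -/
theorem odd_midOf_apply_ne (ε : AEdge) {k : Fin 2} (hk : k ≠ ε.2) : Odd (midOf ε k) :=
  ⟨ε.1 k, by rw [midOf_apply_ne ε hk]⟩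

/-- Midpoints are not image sites. [cite: VanenterFernandezSokal1993, §4.1.2 Step 1] -/
theorem not_isImageSite_midOf (ε : AEdge) : ¬ IsImageSite (midOf ε) := by
  intro h
  have hk : ∀ k, Even (midOf ε k) := by simpa [IsImageSite, Fin.forall_fin_two] using h
  obtain ⟨j, hj⟩ := exists_fin_two_ne ε.2
  exact Int.not_even_iff_odd.2 (odd_midOf_apply_ne ε hj) (hk j)

/-- `midOf` is injective: the even coordinate determines the direction, the centre then the anchor.
[cite: VanenterFernandezSokal1993, §4.1.2 Step 1] -/
theorem midOf_injective : Function.Injective midOf := by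
  rintro ⟨u, i⟩ ⟨v, j⟩ h
  have hij : i = j := by
    by_contra hne
    have h1 : Even (midOf (u, i) i) := even_midOf_apply_same (u, i)
    have h2 : Odd (midOf (v, j) i) := odd_midOf_apply_ne (v, j) hne
    rw [h] at h1
    exact Int.not_even_iff_odd.2 h2 h1
  subst hij
  have huv : u = v := by
    funext k
    have := congr_fun h k
    by_cases hk : k = i
    · subst hk
      rw [show midOf (u, k) k = 2 * u k + 2 from midOf_apply_same (u, k),
        show midOf (v, k) k = 2 * v k + 2 from midOf_apply_same (v, k)] at this
      omega
    · rw [midOf_apply_ne (u, i) hk, midOf_apply_ne (v, i) hk] at this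
      simp only at this
      omega
  rw [huv]

/-- The two centres of a midpoint: `midOf (u,i) - eᵢ = centerEmb u` … [cite: VanenterFernandezSokal1993, §4.1.2 Step 1] -/
theorem midOf_sub_vec (ε : AEdge) : midOf ε - vec ε.2 = centerEmb ε.1 := by
  simp [midOf]

/-- … and `midOf (u,i) + eᵢ = centerEmb (u + eᵢ)`. [cite: VanenterFernandezSokal1993, §4.1.2 Step 1] -/
theorem midOf_add_vec (ε : AEdge) : midOf ε + vec ε.2 = centerEmb ε.tip := by
  funext k
  simp only [midOf, tip, Pi.add_apply, centerEmb_apply]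
  ring

/-- A midpoint lies in `Λ_{2n+2}` iff its anchored bond meets the rescaled box (this includes the
midpoints of layer `Γ_{2n+2}`, whose second centre lies outside the box).
[cite: VanenterFernandezSokal1993, §4.1.2 Step 2] -/
theorem midOf_mem_box_iff {n : ℕ} {ε : AEdge} :
    midOf ε ∈ box 2 (2 * n + 2) ↔ ε ∈ anchT (rescaledBox n) := by
  rw [mem_anchT, mem_box, mem_rescaledBox, mem_rescaledBox]
  obtain ⟨u, i⟩ := ε
  obtain ⟨j, hj⟩ := exists_fin_two_ne i
  have htip_i : tip (u, i) i = u i + 1 := by simp [tip, vec_apply_same]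
  have htip_j : tip (u, i) j = u j := by simp [tip, vec_apply_ne hj]
  have hmi : midOf (u, i) i = 2 * u i + 2 := midOf_apply_same (u, i)
  have hmj : midOf (u, i) j = 2 * u j + 1 := midOf_apply_ne (u, i) hj
  rw [forall_fin_two_iff_of_ne (Ne.symm hj), forall_fin_two_iff_of_ne (Ne.symm hj),
    forall_fin_two_iff_of_ne (Ne.symm hj), hmi, hmj, htip_i, htip_j]
  simp only
  push_cast
  omega

/-- **The midpoints of `Λ_{2n+2}`** as a finite set of sites. [cite: VanenterFernandezSokal1993, §4.1.2 Step 2] -/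
def midFinset (n : ℕ) : Finset (Site 2) := (anchT (rescaledBox n)).image midOf

/-- Membership in `midFinset`. [cite: VanenterFernandezSokal1993, §4.1.2 Step 2] -/
theorem mem_midFinset_iff {n : ℕ} {y : Site 2} :
    y ∈ midFinset n ↔ ∃ ε ∈ anchT (rescaledBox n), midOf ε = y := by
  simp [midFinset]

/-- Midpoints of the box are internal sites. [cite: VanenterFernandezSokal1993, §4.1.2 Step 2] -/
theorem midFinset_subset (n : ℕ) : midFinset n ⊆ internalVolume n := by
  intro y hy
  obtain ⟨ε, hε, rfl⟩ := mem_midFinset_iff.1 hy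
  exact mem_internalVolume_iff.2 ⟨midOf_mem_box_iff.2 hε, not_isImageSite_midOf ε⟩

/-! ### The partition of the internal sites into centres and midpoints -/

/-- **The centres of `Λ_{2n+2}`**: the internal sites that are not midpoints (so that the two-step
decomposition of the Boltzmann sums over `W'_n ⊇ midpoints` freezes exactly the centres); they are
the points `centerEmb x`, `x ∈ rescaledBox n` (`centerFinset_eq_map`).
[cite: VanenterFernandezSokal1993, §4.1.2 Steps 1–2] -/
def centerFinset (n : ℕ) : Finset (Site 2) := internalVolume n \ midFinset n

/-- A centre `centerEmb x` is not a midpoint. [cite: VanenterFernandezSokal1993, §4.1.2 Step 1] -/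
theorem centerEmb_not_mem_midFinset (n : ℕ) (x : Site 2) : centerEmb x ∉ midFinset n := by
  intro hm
  obtain ⟨ε, -, hε⟩ := mem_midFinset_iff.1 hm
  have h1 : Even (midOf ε ε.2) := even_midOf_apply_same ε
  rw [hε] at h1
  exact Int.not_even_iff_odd.2 (odd_centerEmb_apply x ε.2) h1

/-- **Every internal site of `Λ_{2n+2}` is a centre `centerEmb x` (`x` in the rescaled box) or a
midpoint.** [cite: VanenterFernandezSokal1993, §4.1.2 Steps 1–2] -/
theorem exists_centerEmb_or_mem_midFinset {n : ℕ} {y : Site 2} (hy : y ∈ internalVolume n) :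
    (∃ x ∈ rescaledBox n, centerEmb x = y) ∨ y ∈ midFinset n := by
  obtain ⟨hyb, hyi⟩ := mem_internalVolume_iff.1 hy
  rcases Int.even_or_odd (y 0) with e0 | o0 <;> rcases Int.even_or_odd (y 1) with e1 | o1
  · exact absurd ⟨e0, e1⟩ hyi
  · -- midpoint along direction `0`
    right
    obtain ⟨a, ha⟩ := e0
    obtain ⟨b, hb⟩ := o1
    set u : Site 2 := fun k => if k = 0 then a - 1 else b with hu
    have hy : midOf (u, 0) = y := by
      refine funext (Fin.forall_fin_two.2 ⟨?_, ?_⟩)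
      · rw [show midOf (u, 0) 0 = 2 * u 0 + 2 from midOf_apply_same (u, 0)]
        simp [hu]; omega
      · rw [midOf_apply_ne (u, 0) (show (1 : Fin 2) ≠ 0 by decide)]
        simp [hu]; omega
    refine mem_midFinset_iff.2 ⟨(u, 0), ?_, hy⟩
    rw [← midOf_mem_box_iff, hy]; exact hyb
  · -- midpoint along direction `1`
    right
    obtain ⟨a, ha⟩ := o0
    obtain ⟨b, hb⟩ := e1
    set u : Site 2 := fun k => if k = 0 then a else b - 1 with hu
    have hy : midOf (u, 1) = y := by
      refine funext (Fin.forall_fin_two.2 ⟨?_, ?_⟩)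
      · rw [midOf_apply_ne (u, 1) (show (0 : Fin 2) ≠ 1 by decide)]
        simp [hu]; omega
      · rw [show midOf (u, 1) 1 = 2 * u 1 + 2 from midOf_apply_same (u, 1)]
        simp [hu]; omega
    refine mem_midFinset_iff.2 ⟨(u, 1), ?_, hy⟩
    rw [← midOf_mem_box_iff, hy]; exact hyb
  · -- centre
    left
    obtain ⟨a, ha⟩ := o0
    obtain ⟨b, hb⟩ := o1
    set x : Site 2 := fun k => if k = 0 then a else b with hx
    have hy : centerEmb x = y := by
      refine funext (Fin.forall_fin_two.2 ⟨?_, ?_⟩)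
      · simp [hx]; omega
      · simp [hx]; omega
    refine ⟨x, ?_, hy⟩
    rw [← centerEmb_mem_box_iff, hy]; exact hyb

/-- **The centres are the points `2x + (1,1)` of the rescaled box**: `centerFinset n =
(rescaledBox n).map centerEmb` ("a square lattice of size `(R+2) × (R+2)`").
[cite: VanenterFernandezSokal1993, §4.1.2 Step 2, Figure 4(e)] -/
theorem centerFinset_eq_map (n : ℕ) : centerFinset n = (rescaledBox n).map centerEmb := by
  ext y
  rw [centerFinset, Finset.mem_sdiff, Finset.mem_map]
  constructor
  · rintro ⟨hy, hym⟩
    rcases exists_centerEmb_or_mem_midFinset hy with ⟨x, hx, rfl⟩ | h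
    · exact ⟨x, hx, rfl⟩
    · exact absurd h hym
  · rintro ⟨x, hx, rfl⟩
    exact ⟨centerEmb_mem_internalVolume hx, centerEmb_not_mem_midFinset n x⟩

/-- Membership in `centerFinset`. [cite: VanenterFernandezSokal1993, §4.1.2 Step 2] -/
theorem mem_centerFinset_iff {n : ℕ} {y : Site 2} :
    y ∈ centerFinset n ↔ ∃ x ∈ rescaledBox n, centerEmb x = y := by
  rw [centerFinset_eq_map]; simp

/-- Centres of the box are internal sites. [cite: VanenterFernandezSokal1993, §4.1.2 Step 2] -/
theorem centerFinset_subset (n : ℕ) : centerFinset n ⊆ internalVolume n := Finset.sdiff_subset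

/-- Centres and midpoints are distinct kinds of sites. [cite: VanenterFernandezSokal1993, §4.1.2 Step 1] -/
theorem disjoint_centerFinset_midFinset (n : ℕ) : Disjoint (centerFinset n) (midFinset n) :=
  Finset.sdiff_disjoint

/-- `W'_n = centres ∪ midpoints`. [cite: VanenterFernandezSokal1993, §4.1.2 Steps 1–2] -/
theorem internalVolume_eq_union (n : ℕ) : internalVolume n = centerFinset n ∪ midFinset n := by
  rw [centerFinset, Finset.sdiff_union_of_subset (midFinset_subset n)]

/-! ### Neighbours of centres and midpoints -/

/-- The neighbours of a midpoint along its bond are its two centres (never midpoints, never cut).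
[cite: VanenterFernandezSokal1993, §4.1.2 Step 1] -/
theorem midOf_add_smul_vec_same (ε : AEdge) {s : ℤ} (hs : s = 1 ∨ s = -1) :
    midOf ε + s • vec ε.2 = centerEmb (if s = 1 then ε.tip else ε.1) := by
  rcases hs with rfl | rfl
  · rw [if_pos rfl, one_smul, midOf_add_vec]
  · rw [if_neg (by decide), neg_one_smul, ← sub_eq_add_neg, midOf_sub_vec]

/-- The neighbours of a midpoint of the box across its bond are image sites of the box (cut).
[cite: VanenterFernandezSokal1993, §4.1.2 Step 1] -/
theorem isCutSite_midOf_add_smul_vec_ne {n : ℕ} {ε : AEdge} (hε : ε ∈ anchT (rescaledBox n))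
    {k : Fin 2} (hk : k ≠ ε.2) {s : ℤ} (hs : s = 1 ∨ s = -1) :
    IsCutSite n (midOf ε + s • vec k) := by
  have hbox : midOf ε ∈ box 2 (2 * n + 2) := midOf_mem_box_iff.2 hε
  refine ⟨?_, ?_⟩
  · rw [mem_box] at hbox ⊢
    intro l
    by_cases hl : l = k
    · subst hl
      rw [nbr_apply_same]
      have h1 := hbox l
      have hodd : Odd (midOf ε l) := odd_midOf_apply_ne ε hk
      obtain ⟨c, hc⟩ := hodd
      rcases hs with rfl | rfl <;> push_cast at h1 ⊢ <;> omega
    · rw [nbr_apply_ne _ hl]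
      exact hbox l
  · have hiff : IsImageSite (midOf ε + s • vec k) ↔ ∀ l, Even ((midOf ε + s • vec k) l) := by
      simp [IsImageSite, Fin.forall_fin_two]
    rw [hiff, forall_fin_two_iff_of_ne hk]
    constructor
    · rw [nbr_apply_same]
      have hodd : Odd s := by rcases hs with rfl | rfl <;> decide
      exact (odd_midOf_apply_ne ε hk).add_odd hodd
    · rw [nbr_apply_ne _ (Ne.symm hk)]
      exact even_midOf_apply_same ε

/-- The neighbours of a centre of the box are midpoints of the box.
[cite: VanenterFernandezSokal1993, §4.1.2 Step 1] -/
theorem centerEmb_add_smul_vec_mem_midFinset {n : ℕ} {x : Site 2} (hx : x ∈ rescaledBox n)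
    (k : Fin 2) {s : ℤ} (hs : s = 1 ∨ s = -1) : centerEmb x + s • vec k ∈ midFinset n := by
  rcases hs with rfl | rfl
  · refine mem_midFinset_iff.2 ⟨(x, k), mem_anchT.2 (Or.inl hx), ?_⟩
    rw [one_smul]; rfl
  · refine mem_midFinset_iff.2 ⟨(x - vec k, k), mem_anchT.2 (Or.inr ?_), ?_⟩
    · simpa [tip] using hx
    · rw [neg_one_smul, ← sub_eq_add_neg]
      have := midOf_add_vec (x - vec k, k)
      simp only [tip, sub_add_cancel] at this
      rw [← this, add_sub_cancel_right]

end Literature.Barriers.CriticalPhenomena.NonGibbs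

end
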